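import Mathlib.Probability.Moments.SubGaussian
import Summits.QuantumFields.YangMills.Theorems.U1TorusFluxGaussianDomination
import HarnessLib

/-!
# Gross's Gaussian domination (CMP 92 Thm 2.2) for INFINITE-VOLUME limit states of Wilson `U(1)` on `ℤ^d`
# (LINE 28 «gross-sd-transfer» abelian sibling; crux `HistoryTailL`, stmt-QuantumFields-19936; sequel to ✓`U1TorusFluxGaussianDomination`)

Cell `ym3-torus` (YM ladder rung R3 = continuum SU(2) Yang–Mills on T³ — a RUNG, NOT the Clay problem); WIDTH helper seat `ym3-torus-px8` g9.
Helper `--supports stmt-QuantumFields-19936`; THEOREMS ONLY (0 `def`, 0 `sorry`, default heartbeats).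

WHAT.  Print states Thm 2.2 for translation-invariant INFINITE-VOLUME Gibbs states on `ℤ^d` (Lemma 4.1 via DLR).  The tree's notion is
lit `LatticeGaugeDLR.infiniteVolumeLimitPoints u1Rep β` — limit points of the torus Wilson states on bounded continuous cylinder observables
(the states used by lit ✓`U1WardIdentity.u1_linking_ward_identity`).  For EVERY such limit state `μ`, every `β > 0`, every finite bond set
`V ⊂ E(ℤ^d)` and every real `s`, the flux of the exact 2-cochain `d(1_V)`,
`F_V(U) = Σ_p n_p(V)·sin θ_p(U)` (`n_p(V) = zdPlaqCharge (indicatorCharge V) p`, the sum over the plaquettes based in a cube around `V`),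
obeys ★★★ `integral_exp_mul_zdFlux_le`: `∫ exp(s·F_V) dμ ≤ exp(s²·Σ_p n_p(V)²∕(2β))` — the `L → ∞` limit of ✓`integral_exp_mul_flux_le` along
the tori defining `μ`, through the periodisation dictionary of lit ✓`U1WardIdentity` (`actionFlowDeriv_torusCharge`: on a large torus the action
derivative of the induced charge `torusCharge (L+1) V` IS `F_V` read through the periodic lift; `sum_plaqCharge_torusCharge` +
`plaqCharge_torusCharge_plaqProj`: its torus norm `‖d(torusCharge)‖²` IS `Σ_p n_p(V)²`).  Packaged as Mathlib ★★ `hasSubgaussianMGF_zdFlux`, whence the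
Chernoff tail ★ `measureReal_zdFlux_ge_le` for the infinite-volume state.
HONEST SCOPE.  Abelian, in print since 1983; exact cochains of the form `d(1_V)` (indicator 1-cochains — the class the tree's periodisation
`torusCharge` handles); limit states along tori (the tree's `infiniteVolumeLimitPoints`), not general DLR states; Wilson `h` (`α = 1`).
TODO(general form): general finitely supported real 1-cochains `u` on `ℤ^d`; general energies `h″ ≤ α`; arbitrary translation-invariant DLR states.
Nothing about SU(2) ∕ «ShallowFluxSecondMomentL» ∕ (Q) ∕ K1 ∕ `MeanDeviationL` ∕ `HistoryTailL` ∕ any crux or rung statement is proved; YM₃ on T³ is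
rung R3, not Clay; YM gap NOT proved.

Reference: L. Gross, CMP 92 (1983) 137–162, Thm 2.2 and Lemma 4.1 [GrossCMP1983].
-/

set_option autoImplicit false

noncomputable section

open scoped BigOperators NNReal
open MeasureTheory Filter Topology ProbabilityTheory
open Literature.Probability.LatticeModels Literature.MathematicalPhysics.QuantumLattice
open Literature.MathematicalPhysics.QuantumFieldTheory
open AreaLaw
open Summit.QuantumFields.YangMills.Theorems.U1TorusFluxGaussianDomination

namespace Summit.QuantumFields.YangMills.Theorems.U1ZdFluxGaussianDomination

variable {d : ℕ}

/-! ## §1 The `ℤ^d` flux observable `F_V = Σ_p n_p(V)·sin θ_p`: cylinder, continuous, bounded -/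

/-- `F_V` depends only on the bonds of the plaquettes based in the cube `{-(n+1),…,n+1}^d`. [folklore] -/
theorem dependsOn_zdFlux (n : ℕ) (V : Finset (Literature.MathematicalPhysics.QuantumLattice.ZdEdge d)) :
    DependsOn (fun U : LGConfig d Circle => ∑ p ∈ (box d (n + 1) ×ˢ Finset.univ : Finset (ZdPlaquette d)),
        (zdPlaqCharge (indicatorCharge V) p.1 p.2.1.1 p.2.1.2 : ℝ) * u1PlaqIm p.1 p.2.1.1 p.2.1.2 U)
      (((box d (n + 1) ×ˢ Finset.univ : Finset (ZdPlaquette d)).biUnion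
        fun p => Plaq.bonds (p.1, p.2.1.1, p.2.1.2) : Finset (Literature.MathematicalPhysics.QuantumLattice.ZdEdge d)) : Set (Literature.MathematicalPhysics.QuantumLattice.ZdEdge d)) := by
  classical
  intro U U' h
  refine Finset.sum_congr rfl fun p hp => ?_
  congr 1
  exact dependsOn_u1PlaqIm p.1 p.2.1.1 p.2.1.2 fun e he =>
    h e (by rw [Finset.coe_biUnion]; exact Set.mem_biUnion hp he)

/-- `F_V` is continuous. [folklore] -/
theorem continuous_zdFlux (n : ℕ) (V : Finset (Literature.MathematicalPhysics.QuantumLattice.ZdEdge d)) :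
    Continuous fun U : LGConfig d Circle => ∑ p ∈ (box d (n + 1) ×ˢ Finset.univ : Finset (ZdPlaquette d)),
        (zdPlaqCharge (indicatorCharge V) p.1 p.2.1.1 p.2.1.2 : ℝ) * u1PlaqIm p.1 p.2.1.1 p.2.1.2 U :=
  continuous_finsetSum _ fun _ _ => continuous_const.mul (continuous_u1PlaqIm _ _ _)

/-- `|F_V| ≤ Σ_p |n_p(V)|`. [folklore] -/
theorem abs_zdFlux_le (n : ℕ) (V : Finset (Literature.MathematicalPhysics.QuantumLattice.ZdEdge d)) (U : LGConfig d Circle) :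
    |∑ p ∈ (box d (n + 1) ×ˢ Finset.univ : Finset (ZdPlaquette d)),
        (zdPlaqCharge (indicatorCharge V) p.1 p.2.1.1 p.2.1.2 : ℝ) * u1PlaqIm p.1 p.2.1.1 p.2.1.2 U| ≤
      ∑ p ∈ (box d (n + 1) ×ˢ Finset.univ : Finset (ZdPlaquette d)), |(zdPlaqCharge (indicatorCharge V) p.1 p.2.1.1 p.2.1.2 : ℝ)| := by
  refine (Finset.abs_sum_le_sum_abs _ _).trans (Finset.sum_le_sum fun p _ => ?_)
  rw [abs_mul]
  exact (mul_le_mul_of_nonneg_left (abs_u1PlaqIm_le _ _ _ U) (abs_nonneg _)).trans_eq (mul_one _)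

/-! ## §2 The periodisation dictionary: the torus reading of `e^{s·F_V}` and the torus norm of `d(torusCharge V)` -/

/-- On a torus of side `L + 1 ≥ 2(n+2)+1`, the torus reading of `exp(s·F_V)` IS `exp(s·actionFlowDeriv (torusCharge (L+1) V))`
(lit `actionFlowDeriv_torusCharge`). [folklore] -/
theorem toTorusObservable_exp_mul_zdFlux {n L : ℕ} (hL : 2 * (n + 2) ≤ L) {V : Finset (Literature.MathematicalPhysics.QuantumLattice.ZdEdge d)}
    (hV : ∀ v ∈ V, v.1 ∈ box d n) (s : ℝ) :
    toTorusObservable (L + 1) (fun U : LGConfig d Circle => Real.exp (s *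
        ∑ p ∈ (box d (n + 1) ×ˢ Finset.univ : Finset (ZdPlaquette d)),
          (zdPlaqCharge (indicatorCharge V) p.1 p.2.1.1 p.2.1.2 : ℝ) * u1PlaqIm p.1 p.2.1.1 p.2.1.2 U)) =
      fun U : GaugeConfig d (L + 1) Circle => Real.exp (s * actionFlowDeriv (torusCharge (L + 1) V) U) := by
  funext U
  rw [toTorusObservable_apply, actionFlowDeriv_torusCharge hL hV U]
  rfl

/-- On such a torus the norm of the induced coboundary IS the `ℤ^d` norm: `Σ_q (plaqCharge (torusCharge (L+1) V) q)² = Σ_p n_p(V)²`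
(lit `sum_plaqCharge_torusCharge` + `plaqCharge_torusCharge_plaqProj`). [folklore] -/
theorem sum_sq_plaqCharge_torusCharge {n L : ℕ} (hL : 2 * (n + 2) ≤ L) {V : Finset (Literature.MathematicalPhysics.QuantumLattice.ZdEdge d)}
    (hV : ∀ v ∈ V, v.1 ∈ box d n) :
    ∑ q : Plaquette d (L + 1), (plaqCharge (torusCharge (L + 1) V) q.1 q.2.1.1 q.2.1.2 : ℝ) ^ 2 =
      ∑ p ∈ (box d (n + 1) ×ˢ Finset.univ : Finset (ZdPlaquette d)),
        (zdPlaqCharge (indicatorCharge V) p.1 p.2.1.1 p.2.1.2 : ℝ) ^ 2 := by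
  have h := sum_plaqCharge_torusCharge hL hV (fun q => (plaqCharge (torusCharge (L + 1) V) q.1 q.2.1.1 q.2.1.2 : ℝ))
  simp only [← sq] at h
  rw [h]
  refine Finset.sum_congr rfl fun p hp => ?_
  have hV' : ∀ v ∈ V, v.1 ∈ box d (n + 1) := fun v hv => mem_box_succ (hV v hv)
  rw [plaqProj, plaqCharge_torusCharge_plaqProj (n := n + 1) (by omega) hV' (Finset.mem_product.1 hp).1, sq]

/-! ## §3 Gaussian domination for infinite-volume limit states -/

/-- ★★★ **GROSS'S GAUSSIAN DOMINATION (CMP 92 Thm 2.2) FOR INFINITE-VOLUME LIMIT STATES OF WILSON `U(1)` ON `ℤ^d`.**  For `β > 0`, every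
limit state `μ ∈ infiniteVolumeLimitPoints u1Rep β`, every finite bond set `V` based in `{-n,…,n}^d` and every real `s`:
`∫ exp(s·F_V) dμ ≤ exp(s²·Σ_p n_p(V)²∕(2β))`, `F_V = Σ_p n_p(V) sin θ_p` the flux of the exact 2-cochain `d(1_V)` — the torus theorem
✓`integral_exp_mul_flux_le` for the induced charges `torusCharge (L+1) V`, read on `ℤ^d` by §2, passed to the limit along the tori defining `μ`
(`exp(s·F_V)` is a bounded continuous cylinder observable). [cite: GrossCMP1983, Thm 2.2 + Lemma 4.1] -/
theorem integral_exp_mul_zdFlux_le {β : ℝ} (hβ : 0 < β) {μ : Measure (LGConfig d Circle)}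
    (hμ : μ ∈ infiniteVolumeLimitPoints (d := d) u1Rep β) {n : ℕ} {V : Finset (Literature.MathematicalPhysics.QuantumLattice.ZdEdge d)}
    (hV : ∀ v ∈ V, v.1 ∈ box d n) (s : ℝ) :
    ∫ U, Real.exp (s * ∑ p ∈ (box d (n + 1) ×ˢ Finset.univ : Finset (ZdPlaquette d)),
        (zdPlaqCharge (indicatorCharge V) p.1 p.2.1.1 p.2.1.2 : ℝ) * u1PlaqIm p.1 p.2.1.1 p.2.1.2 U) ∂μ ≤
      Real.exp (s ^ 2 * (∑ p ∈ (box d (n + 1) ×ˢ Finset.univ : Finset (ZdPlaquette d)),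
        (zdPlaqCharge (indicatorCharge V) p.1 p.2.1.1 p.2.1.2 : ℝ) ^ 2) / (2 * β)) := by
  classical
  obtain ⟨Ls, hLs, -, hconv⟩ := hμ
  have hlim := hconv (fun U : LGConfig d Circle => Real.exp (s *
      ∑ p ∈ (box d (n + 1) ×ˢ Finset.univ : Finset (ZdPlaquette d)),
        (zdPlaqCharge (indicatorCharge V) p.1 p.2.1.1 p.2.1.2 : ℝ) * u1PlaqIm p.1 p.2.1.1 p.2.1.2 U))
    (((box d (n + 1) ×ˢ Finset.univ : Finset (ZdPlaquette d)).biUnion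
        fun p => Plaq.bonds (p.1, p.2.1.1, p.2.1.2)))
    (fun U U' h => by simp only [dependsOn_zdFlux n V h])
    (Real.continuous_exp.comp (continuous_const.mul (continuous_zdFlux n V)))
    ⟨Real.exp (|s| * ∑ p ∈ (box d (n + 1) ×ˢ Finset.univ : Finset (ZdPlaquette d)),
        |(zdPlaqCharge (indicatorCharge V) p.1 p.2.1.1 p.2.1.2 : ℝ)|), fun U => by
      rw [abs_of_pos (Real.exp_pos _)]
      refine Real.exp_le_exp.2 ?_
      calc s * _ ≤ |s * ∑ p ∈ (box d (n + 1) ×ˢ Finset.univ : Finset (ZdPlaquette d)),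
              (zdPlaqCharge (indicatorCharge V) p.1 p.2.1.1 p.2.1.2 : ℝ) * u1PlaqIm p.1 p.2.1.1 p.2.1.2 U| := le_abs_self _
        _ = |s| * |∑ p ∈ (box d (n + 1) ×ˢ Finset.univ : Finset (ZdPlaquette d)),
              (zdPlaqCharge (indicatorCharge V) p.1 p.2.1.1 p.2.1.2 : ℝ) * u1PlaqIm p.1 p.2.1.1 p.2.1.2 U| := abs_mul _ _
        _ ≤ |s| * _ := mul_le_mul_of_nonneg_left (abs_zdFlux_le n V U) (abs_nonneg _)⟩
  -- eventually along the tori the torus expectation is bounded by the torus theorem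
  have hev : ∀ᶠ k : ℕ in atTop,
      wilsonExpectation (L := Ls k + 1) u1Rep β (toTorusObservable (Ls k + 1) (fun U : LGConfig d Circle => Real.exp (s *
        ∑ p ∈ (box d (n + 1) ×ˢ Finset.univ : Finset (ZdPlaquette d)),
          (zdPlaqCharge (indicatorCharge V) p.1 p.2.1.1 p.2.1.2 : ℝ) * u1PlaqIm p.1 p.2.1.1 p.2.1.2 U))) ≤
      Real.exp (s ^ 2 * (∑ p ∈ (box d (n + 1) ×ˢ Finset.univ : Finset (ZdPlaquette d)),
        (zdPlaqCharge (indicatorCharge V) p.1 p.2.1.1 p.2.1.2 : ℝ) ^ 2) / (2 * β)) := by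
    filter_upwards [hLs.tendsto_atTop.eventually (eventually_ge_atTop (2 * (n + 2)))] with k hk
    rw [toTorusObservable_exp_mul_zdFlux hk hV s, ← sum_sq_plaqCharge_torusCharge hk hV]
    exact wilsonExpectation_exp_mul_flux_le (torusCharge (Ls k + 1) V) hβ s
  exact le_of_tendsto hlim hev

/-- ★★ **SUB-GAUSSIAN PACKAGING (Mathlib `HasSubgaussianMGF`) FOR THE INFINITE-VOLUME FLUX** with proxy `Σ_p n_p(V)²∕β`.
[cite: GrossCMP1983, Thm 2.2] -/
theorem hasSubgaussianMGF_zdFlux {β : ℝ} (hβ : 0 < β) {μ : Measure (LGConfig d Circle)}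
    (hμ : μ ∈ infiniteVolumeLimitPoints (d := d) u1Rep β) {n : ℕ} {V : Finset (Literature.MathematicalPhysics.QuantumLattice.ZdEdge d)}
    (hV : ∀ v ∈ V, v.1 ∈ box d n) :
    HasSubgaussianMGF (fun U : LGConfig d Circle => ∑ p ∈ (box d (n + 1) ×ˢ Finset.univ : Finset (ZdPlaquette d)),
        (zdPlaqCharge (indicatorCharge V) p.1 p.2.1.1 p.2.1.2 : ℝ) * u1PlaqIm p.1 p.2.1.1 p.2.1.2 U)
      (Real.toNNReal ((∑ p ∈ (box d (n + 1) ×ˢ Finset.univ : Finset (ZdPlaquette d)),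
        (zdPlaqCharge (indicatorCharge V) p.1 p.2.1.1 p.2.1.2 : ℝ) ^ 2) / β)) μ := by
  haveI : IsProbabilityMeasure μ := by
    obtain ⟨Ls, -, hprob, -⟩ := hμ
    exact hprob
  have hN : 0 ≤ (∑ p ∈ (box d (n + 1) ×ˢ Finset.univ : Finset (ZdPlaquette d)),
      (zdPlaqCharge (indicatorCharge V) p.1 p.2.1.1 p.2.1.2 : ℝ) ^ 2) / β :=
    div_nonneg (Finset.sum_nonneg fun _ _ => sq_nonneg _) hβ.le
  refine ⟨fun t => ?_, fun t => ?_⟩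
  · refine Integrable.of_bound ((Real.continuous_exp.comp (continuous_const.mul (continuous_zdFlux n V))).measurable.aestronglyMeasurable)
      (Real.exp (|t| * ∑ p ∈ (box d (n + 1) ×ˢ Finset.univ : Finset (ZdPlaquette d)),
        |(zdPlaqCharge (indicatorCharge V) p.1 p.2.1.1 p.2.1.2 : ℝ)|)) (ae_of_all _ fun U => ?_)
    rw [Real.norm_eq_abs, abs_of_pos (Real.exp_pos _)]
    refine Real.exp_le_exp.2 ((le_abs_self _).trans ?_)
    rw [abs_mul]
    exact mul_le_mul_of_nonneg_left (abs_zdFlux_le n V U) (abs_nonneg _)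
  · simp only [mgf, Real.coe_toNNReal _ hN]
    refine (integral_exp_mul_zdFlux_le hβ hμ hV t).trans_eq ?_
    congr 1; ring

/-- ★ **THE SUB-GAUSSIAN FLUX TAIL FOR INFINITE-VOLUME LIMIT STATES**: `μ{θ ≤ F_V} ≤ exp(−θ²∕(2·Σ_p n_p(V)²∕β))` for `θ ≥ 0`
(Mathlib `HasSubgaussianMGF.measure_ge_le`). [cite: GrossCMP1983, Thm 2.2 (consequence)] -/
theorem measureReal_zdFlux_ge_le {β : ℝ} (hβ : 0 < β) {μ : Measure (LGConfig d Circle)}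
    (hμ : μ ∈ infiniteVolumeLimitPoints (d := d) u1Rep β) {n : ℕ} {V : Finset (Literature.MathematicalPhysics.QuantumLattice.ZdEdge d)}
    (hV : ∀ v ∈ V, v.1 ∈ box d n) {θ : ℝ} (hθ : 0 ≤ θ) :
    μ.real {U | θ ≤ ∑ p ∈ (box d (n + 1) ×ˢ Finset.univ : Finset (ZdPlaquette d)),
        (zdPlaqCharge (indicatorCharge V) p.1 p.2.1.1 p.2.1.2 : ℝ) * u1PlaqIm p.1 p.2.1.1 p.2.1.2 U} ≤
      Real.exp (-θ ^ 2 / (2 * ((∑ p ∈ (box d (n + 1) ×ˢ Finset.univ : Finset (ZdPlaquette d)),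
        (zdPlaqCharge (indicatorCharge V) p.1 p.2.1.1 p.2.1.2 : ℝ) ^ 2) / β))) := by
  have hN : 0 ≤ (∑ p ∈ (box d (n + 1) ×ˢ Finset.univ : Finset (ZdPlaquette d)),
      (zdPlaqCharge (indicatorCharge V) p.1 p.2.1.1 p.2.1.2 : ℝ) ^ 2) / β :=
    div_nonneg (Finset.sum_nonneg fun _ _ => sq_nonneg _) hβ.le
  have h := (hasSubgaussianMGF_zdFlux hβ hμ hV).measure_ge_le hθ
  rw [Real.coe_toNNReal _ hN] at h
  exact h

end Summit.QuantumFields.YangMills.Theorems.U1ZdFluxGaussianDomination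

end
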